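import Summits.Ventures.Crystal3D.Theorems.StickyWulffConstantCoaxialWallLawEndRowIntReadings
import Summits.Ventures.Crystal3D.Theorems.StickyWulffConstantCoaxialWallLawSaturatedReaders
import Summits.Ventures.Crystal3D.Theorems.StickyWulffConstantCoaxialWallLawEndRowPattern
import Summits.Ventures.Crystal3D.Theorems.StickyWulffConstantCoaxialWallLawSeamMotifDefs
import HarnessLib

/-!
# Sticky Wulff constant — coaxial wall law, T5b: the TWIN–TWIN DICHOTOMY, part 1 (integer-model core)

Support file for `stmt-Ventures-19481` (lane F 'Certificates', T5b reader-lattice graph; cf-p1 (ccxv)(A), (ccxx)).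
Part 1 of the kernel proof of `TailResidue.TwinTwinDichotomy` (part 2: `…TwinTwinDichotomy`): both readers presented
in the model frame `EndRowFloor.L`, the first at the model origin `P 0`.

* §1 soundness of a twin reading `IsTwinReading X L (menuOf (cubeInt c)) (P u)` for an ARBITRARY configuration `X`
  (the model points it forces into / out of `X`);
* §2 the computable position lists `twinOccList`, `twinEmpList`, the conflict test `twinConflict` and its soundness
  (a conflict contradicts `1`-separation);
* §3 the finite TRICHOTOMY TABLE (`8 × 8 × 15` cases, kernel `decide`): same axis, or a conflict, or the Σ9 condition;
* §4 the model dichotomy in a common frame `twinTwin_model_sameFrame`;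
* §5 TWIN DUALITY `twin_dual`: a twin reader for `(L, m)` is one for the mirror frame `L ∘ R_m` about `−m`.
-/

noncomputable section

namespace Summit.Ventures.Crystal3D.Theorems

namespace EndRowFloor

open Summit.Ventures.Crystal3D Finset NearIdentity TailResidue
open scoped InnerProductSpace

variable {X : Finset (EuclideanSpace ℝ (Fin 3))}

/-! ### §1 Soundness of a model twin reading in an arbitrary configuration -/

/-- A model twin reading puts the closed lower half-dozen into `X`. -/
theorem twin_mem_low {u : Fin 3 → ℤ} {c : Fin 8} (h : IsTwinReading X L (menuOf (cubeInt c)) (P u)) (i : Fin 12)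
    (hd : dz (slotInt i) (cubeInt c) ≤ 0) : P (u + slot3 i) ∈ X := by
  have hin := inner_L_slotSite_menuOf i (cubeInt c)
  have := h.2.1 (slotSite i) (slotSite_mem i) (by
    rw [hin]; exact div_nonpos_of_nonpos_of_nonneg (by exact_mod_cast hd) sqrt6_pos.le)
  rwa [P_add_slot] at this

/-- A model twin reading puts the three mirrored balls into `X`. -/
theorem twin_mem_mirror {u : Fin 3 → ℤ} {c : Fin 8} (h : IsTwinReading X L (menuOf (cubeInt c)) (P u)) (i : Fin 12)
    (hd : dz (slotInt i) (cubeInt c) < 0) : P (u + mirrorVec i (cubeInt c)) ∈ X := by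
  have hin := inner_L_slotSite_menuOf i (cubeInt c)
  have := h.2.2.1 (slotSite i) (slotSite_mem i) (by
    rw [hin]; exact div_neg_of_neg_of_pos (by exact_mod_cast hd) sqrt6_pos)
  rwa [mirror_slot_menuOf, P_add_Qr] at this

/-- A model twin reading keeps the far triple out of `X`. -/
theorem twin_not_mem_far {u : Fin 3 → ℤ} {c : Fin 8} (h : IsTwinReading X L (menuOf (cubeInt c)) (P u)) (i : Fin 12)
    (hd : 0 < dz (slotInt i) (cubeInt c)) : P (u + slot3 i) ∉ X := by
  have hin := inner_L_slotSite_menuOf i (cubeInt c)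
  have := h.2.2.2 (slotSite i) (slotSite_mem i) (by rw [hin]; have := sqrt6_pos; positivity)
  rwa [P_add_slot] at this

/-! ### §2 Position lists and the conflict test -/

/-- The `15` model points a twin reading at `u` about the sign vector `k` forces INTO `X` (as a list). -/
def twinOccList (k u : Fin 3 → ℤ) : List (Fin 3 → ℤ) :=
  ((List.finRange 12).filter fun i => dz (slotInt i) k ≤ 0).map (fun i => u + slot3 i) ++
    ((List.finRange 12).filter fun i => dz (slotInt i) k < 0).map (fun i => u + mirrorVec i k)

/-- The `3` model points a twin reading at `u` about `k` forces OUT of `X`. -/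
def twinEmpList (k u : Fin 3 → ℤ) : List (Fin 3 → ℤ) :=
  ((List.finRange 12).filter fun i => 0 < dz (slotInt i) k).map (fun i => u + slot3 i)

/-- Componentwise equality test of integer triples. -/
def veq (a b : Fin 3 → ℤ) : Bool := a 0 == b 0 && a 1 == b 1 && a 2 == b 2

/-- `veq` is sound. -/
theorem eq_of_veq {a b : Fin 3 → ℤ} (h : veq a b = true) : a = b := by
  simp only [veq, Bool.and_eq_true, beq_iff_eq] at h
  funext j; fin_cases j
  · exact h.1.1
  · exact h.1.2
  · exact h.2

/-- The CONFLICT TEST of the twin reading at `0` about `k₁` against the twin reading at `v` about `k₂`: a point forced in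
by one and out by the other, or two distinct forced-in points at (integer-model) squared distance `< 18`. -/
def twinConflict (k₁ k₂ v : Fin 3 → ℤ) : Bool :=
  (twinOccList k₁ 0).any (fun a => (twinEmpList k₂ v).any fun b => veq a b) ||
  (twinEmpList k₁ 0).any (fun a => (twinOccList k₂ v).any fun b => veq a b) ||
  (twinOccList k₁ 0).any (fun a => (twinOccList k₂ v).any fun b => !veq a b && decide (dz (a - b) (a - b) < 18))

/-- Soundness of `twinOccList`. -/
theorem mem_of_twinOccList {u a : Fin 3 → ℤ} {c : Fin 8} (h : IsTwinReading X L (menuOf (cubeInt c)) (P u))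
    (ha : a ∈ twinOccList (cubeInt c) u) : P a ∈ X := by
  simp only [twinOccList, List.mem_append, List.mem_map, List.mem_filter, List.mem_finRange, true_and,
    decide_eq_true_eq] at ha
  rcases ha with ⟨i, hi, rfl⟩ | ⟨i, hi, rfl⟩
  · exact twin_mem_low h i hi
  · exact twin_mem_mirror h i hi

/-- Soundness of `twinEmpList`. -/
theorem not_mem_of_twinEmpList {u a : Fin 3 → ℤ} {c : Fin 8} (h : IsTwinReading X L (menuOf (cubeInt c)) (P u))
    (ha : a ∈ twinEmpList (cubeInt c) u) : P a ∉ X := by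
  simp only [twinEmpList, List.mem_map, List.mem_filter, List.mem_finRange, true_and, decide_eq_true_eq] at ha
  obtain ⟨i, hi, rfl⟩ := ha
  exact twin_not_mem_far h i hi

/-- **Soundness of the conflict test**: a conflict contradicts `1`-separation. -/
theorem false_of_twinConflict (hX : ∀ p ∈ X, ∀ q ∈ X, p ≠ q → 1 ≤ dist p q) {c₁ c₂ : Fin 8} {v : Fin 3 → ℤ}
    (hc : twinConflict (cubeInt c₁) (cubeInt c₂) v = true) (h₁ : IsTwinReading X L (menuOf (cubeInt c₁)) (P 0))
    (h₂ : IsTwinReading X L (menuOf (cubeInt c₂)) (P v)) : False := by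
  simp only [twinConflict, Bool.or_eq_true, List.any_eq_true, Bool.and_eq_true, Bool.not_eq_true',
    decide_eq_true_eq] at hc
  rcases hc with (⟨a, ha, b, hb, hab⟩ | ⟨a, ha, b, hb, hab⟩) | ⟨a, ha, b, hb, hab, hd⟩
  · rw [eq_of_veq hab] at ha
    exact not_mem_of_twinEmpList h₂ hb (mem_of_twinOccList h₁ ha)
  · rw [eq_of_veq hab] at ha
    exact not_mem_of_twinEmpList h₁ ha (mem_of_twinOccList h₂ hb)
  · have hne : P a ≠ P b := by
      intro he
      have := P_injective he
      rw [this] at hab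
      simp [veq] at hab
    have h1 := hX _ (mem_of_twinOccList h₁ ha) _ (mem_of_twinOccList h₂ hb) hne
    rw [dist_P, one_le_dist_ipt_iff] at h1
    omega

/-! ### §3 The finite trichotomy table -/

/-- Same twin axis: `k₂ = ± k₁`. -/
def sameAxis (k₁ k₂ : Fin 3 → ℤ) : Bool := veq k₂ k₁ || veq k₂ (-k₁)

/-- The Σ9 CONDITION (own form): normals at `k₁ · k₂ = −1` and `v` a slot negative for `k₁`, positive for `k₂`. -/
def sigma9Good (k₁ k₂ v : Fin 3 → ℤ) : Bool :=
  (dz k₁ k₂ == -1) && (List.finRange 12).any fun i => veq v (slot3 i) && decide (dz (slotInt i) k₁ < 0) &&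
    decide (0 < dz (slotInt i) k₂)

/-- **THE TRICHOTOMY TABLE** (`8 × 8 × 15` cases, by `decide`): for two model twin readings at the origin and at a point
of the first reader's twin dozen, the axes agree, or the readings conflict, or the Σ9 condition holds. -/
theorem twin_table : ∀ c₁ c₂ : Fin 8, ∀ v ∈ twinOccList (cubeInt c₁) 0,
    sameAxis (cubeInt c₁) (cubeInt c₂) = true ∨ twinConflict (cubeInt c₁) (cubeInt c₂) v = true ∨
      sigma9Good (cubeInt c₁) (cubeInt c₂) v = true := by
  decide

/-! ### §4 The model dichotomy in a common frame -/

/-- `⟪menuOf k₁, menuOf k₂⟫ = (k₁ · k₂)/3`. -/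
theorem inner_menuOf (k₁ k₂ : Fin 3 → ℤ) : ⟪menuOf k₁, menuOf k₂⟫_ℝ = (dz k₁ k₂ : ℝ) / 3 := by
  rw [menuOf, menuOf, real_inner_smul_left, real_inner_smul_right, Qr.inner_map_map, inner_ipt]
  have h66 : Real.sqrt 6 * Real.sqrt 6 = 6 := Real.mul_self_sqrt (by norm_num)
  have : Real.sqrt 6 * (Real.sqrt 6 * ((dz k₁ k₂ : ℝ) / 18)) = Real.sqrt 6 * Real.sqrt 6 * (dz k₁ k₂ : ℝ) / 18 := by
    ring
  rw [this, h66]; ring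

/-- `menuOf (−k) = −menuOf k`. -/
theorem menuOf_neg (k : Fin 3 → ℤ) : menuOf (-k) = -menuOf k := by
  have : ipt (-k) = -ipt k := by
    ext j; simp [ipt_apply]
  rw [menuOf, menuOf, this, map_neg, smul_neg]

/-- The contact `q₂` of a model twin reader at `P 0` is `P v` for a member `v` of the occupied list. -/
theorem exists_occList_of_contact (hX : ∀ p ∈ X, ∀ q ∈ X, p ≠ q → 1 ≤ dist p q) {c : Fin 8}
    {q₂ : EuclideanSpace ℝ (Fin 3)} (h₁ : IsTwinReading X L (menuOf (cubeInt c)) (P 0)) (hq₂ : q₂ ∈ X)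
    (hd : dist (P 0) q₂ = 1) : ∃ v ∈ twinOccList (cubeInt c) 0, q₂ = P v := by
  have h6 := sqrt6_pos
  rcases mem_twinDozen_of_contact_of_isTwinReading hX h₁ hq₂ hd with ⟨w, hw, hle, hq⟩ | ⟨w, hw, hlt, hq⟩
  · obtain ⟨i, rfl⟩ := exists_slotSite_eq hw
    rw [inner_L_slotSite_menuOf] at hle
    have hdz : dz (slotInt i) (cubeInt c) ≤ 0 := by
      by_contra hpos
      push Not at hpos
      have : (0 : ℝ) < (dz (slotInt i) (cubeInt c) : ℝ) / Real.sqrt 6 := by positivity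
      linarith
    refine ⟨0 + slot3 i, ?_, by rw [hq, P_add_slot]⟩
    simp only [twinOccList, List.mem_append, List.mem_map, List.mem_filter, List.mem_finRange, true_and,
      decide_eq_true_eq]
    exact Or.inl ⟨i, hdz, rfl⟩
  · obtain ⟨i, rfl⟩ := exists_slotSite_eq hw
    have hlt' := hlt
    rw [inner_L_slotSite_menuOf] at hlt'
    have hdz : dz (slotInt i) (cubeInt c) < 0 := by
      by_contra hnn
      push Not at hnn
      have : (0 : ℝ) ≤ (dz (slotInt i) (cubeInt c) : ℝ) / Real.sqrt 6 := by positivity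
      linarith
    refine ⟨0 + mirrorVec i (cubeInt c), ?_, by rw [hq, mirror_slot_menuOf, P_add_Qr]⟩
    simp only [twinOccList, List.mem_append, List.mem_map, List.mem_filter, List.mem_finRange, true_and,
      decide_eq_true_eq]
    exact Or.inr ⟨i, hdz, rfl⟩

/-- **THE MODEL DICHOTOMY IN A COMMON FRAME.**  Two twin readers of a `1`-separated `X` presented in the model frame
`L`, the first at `P 0`, the second at a contact `q₂` of the first: same axis, or the Σ9 pair (own form). -/
theorem twinTwin_model_sameFrame (hX : ∀ p ∈ X, ∀ q ∈ X, p ≠ q → 1 ≤ dist p q)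
    {m₁ m₂ q₂ : EuclideanSpace ℝ (Fin 3)} (h₁ : IsTwinReading X L m₁ (P 0)) (h₂ : IsTwinReading X L m₂ q₂)
    (hq₂ : q₂ ∈ X) (hd : dist (P 0) q₂ = 1) : (m₂ = m₁ ∨ m₂ = -m₁) ∨ Sigma9TwinPairOwn X (P 0) q₂ := by
  obtain ⟨c₁, rfl⟩ := exists_menuOf_of_menu h₁.1
  obtain ⟨c₂, rfl⟩ := exists_menuOf_of_menu h₂.1
  obtain ⟨v, hv, rfl⟩ := exists_occList_of_contact hX h₁ hq₂ hd
  rcases twin_table c₁ c₂ v hv with hs | hc | hg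
  · left
    simp only [sameAxis, Bool.or_eq_true] at hs
    rcases hs with hs | hs
    · left; rw [eq_of_veq hs]
    · right; rw [eq_of_veq hs, menuOf_neg]
  · exact (false_of_twinConflict hX hc h₁ h₂).elim
  · right
    simp only [sigma9Good, Bool.and_eq_true, beq_iff_eq, List.any_eq_true, List.mem_finRange, true_and,
      decide_eq_true_eq] at hg
    obtain ⟨hkk, i, ⟨⟨hvi, hneg⟩, hpos⟩⟩ := hg
    have h6 := sqrt6_pos
    refine ⟨L, menuOf (cubeInt c₁), menuOf (cubeInt c₂), slotSite i, h₁, h₂, ?_, slotSite_mem i, ?_, ?_, ?_⟩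
    · rw [inner_menuOf, hkk]; norm_num
    · rw [inner_L_slotSite_menuOf]; exact div_neg_of_neg_of_pos (by exact_mod_cast hneg) h6
    · rw [inner_L_slotSite_menuOf]; positivity
    · rw [P_add_slot, zero_add, eq_of_veq hvi]

/-! ### §5 Twin duality in the model -/

/-- Finite fact: every mirrored FAR slot lies within model distance `< 1` of a lower slot. -/
theorem far_mirror_near_tab : ∀ c : Fin 8, ∀ i : Fin 12, 0 < dz (slotInt i) (cubeInt c) →
    ∃ j : Fin 12, dz (slotInt j) (cubeInt c) ≤ 0 ∧ veq (mirrorVec i (cubeInt c)) (slot3 j) = false ∧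
      dz (mirrorVec i (cubeInt c) - slot3 j) (mirrorVec i (cubeInt c) - slot3 j) < 18 := by
  decide

/-- **TWIN DUALITY** (model form): a twin reader for `(L, m)` is a twin reader for the mirror frame `L ∘ R_m` about
`−m` — the mirrored far triple is excluded by `1`-separation. -/
theorem twin_dual (hX : ∀ p ∈ X, ∀ q ∈ X, p ≠ q → 1 ≤ dist p q) {u : Fin 3 → ℤ} {c : Fin 8}
    (h : IsTwinReading X L (menuOf (cubeInt c)) (P u)) :
    IsTwinReading X (L.trans (ℝ ∙ menuOf (cubeInt c))ᗮ.reflection) (-menuOf (cubeInt c)) (P u) := by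
  set m := menuOf (cubeInt c) with hm
  have hn : ‖m‖ = 1 := h.1.1
  have hRm : (ℝ ∙ m)ᗮ.reflection m = -m := Submodule.reflection_orthogonalComplement_singleton_eq_neg m
  -- the key identity `⟪R (L w), −m⟫ = ⟪L w, m⟫`
  have key : ∀ w, ⟪(L.trans (ℝ ∙ m)ᗮ.reflection) w, -m⟫_ℝ = ⟪L w, m⟫_ℝ := by
    intro w
    rw [LinearIsometryEquiv.trans_apply, inner_neg_right]
    have := ((ℝ ∙ m)ᗮ.reflection).inner_map_map (L w) m
    rw [hRm, inner_neg_right] at this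
    rw [← LinearIsometryEquiv.inner_map_map (ℝ ∙ m)ᗮ.reflection ((ℝ ∙ m)ᗮ.reflection (L w)) m,
      Submodule.reflection_reflection, hRm, inner_neg_right, neg_neg]
  have happ : ∀ w, (L.trans (ℝ ∙ m)ᗮ.reflection) w = L w - (2 * ⟪L w, m⟫_ℝ) • m := fun w => by
    rw [LinearIsometryEquiv.trans_apply, reflection_unit_apply hn]
  refine ⟨⟨by rw [norm_neg, hn], fun w hw => ?_⟩, fun w hw hle => ?_, fun w hw hlt => ?_, fun w hw hpos => ?_⟩
  · rw [key]
    rcases h.1.2 w hw with h0 | h0 | h0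
    · exact Or.inl h0
    · exact Or.inr (Or.inl h0)
    · exact Or.inr (Or.inr h0)
  · rw [key] at hle
    rw [happ]
    rcases hle.lt_or_eq with hlt | he
    · exact h.2.2.1 w hw hlt
    · rw [he]; simpa using h.2.1 w hw hle
  · rw [key] at hlt
    rw [key, happ]
    have : L w - (2 * ⟪L w, m⟫_ℝ) • m - (2 * ⟪L w, m⟫_ℝ) • -m = L w := by
      rw [smul_neg]; abel
    rw [this]
    exact h.2.1 w hw hlt.le
  · rw [key] at hpos
    rw [happ]
    obtain ⟨i, rfl⟩ := exists_slotSite_eq hw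
    have hpos' := hpos
    rw [inner_L_slotSite_menuOf] at hpos'
    have hdz : 0 < dz (slotInt i) (cubeInt c) := by
      by_contra hnp
      push Not at hnp
      have : (dz (slotInt i) (cubeInt c) : ℝ) / Real.sqrt 6 ≤ 0 :=
        div_nonpos_of_nonpos_of_nonneg (by exact_mod_cast hnp) sqrt6_pos.le
      linarith
    obtain ⟨j, hj, hne, hlt⟩ := far_mirror_near_tab c i hdz
    rw [hm, mirror_slot_menuOf, P_add_Qr]
    intro hmem
    have hocc := twin_mem_low h j hj
    have hneq : P (u + mirrorVec i (cubeInt c)) ≠ P (u + slot3 j) := by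
      intro he
      have := add_left_cancel (P_injective he)
      rw [this] at hne
      simp [veq] at hne
    have h1 := hX _ hmem _ hocc hneq
    rw [dist_P, one_le_dist_ipt_iff] at h1
    have : u + mirrorVec i (cubeInt c) - (u + slot3 j) = mirrorVec i (cubeInt c) - slot3 j := by abel
    rw [this] at h1
    omega

end EndRowFloor

end Summit.Ventures.Crystal3D.Theorems

end
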